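import Summits.Ventures.PercRepro.GenQClassTwelveFour

/-!
# PercRepro — the corank-`12` split, part G: one `15`-trace leaves at most three `16`-traces (night-4, gen 14)

At `n = 19` with `h₁₅ = 1`: two `16`-traces meeting `G` in `15` points would force `h₁₅ = 0` (every `15`-trace contains
their rank-`5` flat and is then its trace, not spanning — `hypTr_fifteen_eq_zero_of_card_inter_eq_fifteen_n19`); a pair
meeting in `14` points produces the `15`-trace `cl(F ∪ y)` with trace `(F ∩ G) ∪ {y}`, `y` the point outside both
(`exists_fifteen_of_card_inter_eq_fourteen_n19`, part E's construction made explicit) — and then NO third `16`-trace `H₃`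
exists (`false_of_pair_fourteen_and_third_n19`): a pair `(H₁, H₃)` meeting in `14` points would produce the same unique
`15`-trace with the same outside point `y`, so `H₃ ⊇ F` and `H₃ = cl(F ∪ x)` for a point `x` of `H₁` or `H₂`; while
pairs meeting in `13` points put the `3`-point complement of `H₃` inside `F ∩ G`, so `F ∩ H₃` is a flat of rank `≤ 4`
with `≥ 11` points.  Four `16`-traces are therefore pairwise `13`-meeting — part F's contradiction.  Hence
**`hypTr_sixteen_le_three_of_fifteen_one`**: `h₁₅ = 1 ⇒ h₁₆ ≤ 3`; the class `(h₁₆ = 4, h₁₅ = 1)` of the corank-`12` split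
(`−18,753` on tree rows) is EMPTY.  Imports `GenQClassTwelveFour` (parts A–F).
-/
namespace PercRepro.Night4

open Finset ThmH SixFour GenQ PerFlat Star

variable {α : Type*} [DecidableEq α] {M : Matroid α} [M.Finite]

/-- Two `16`-traces meeting `G` in `15` points leave no `15`-trace (`n = 19`). -/
theorem hypTr_fifteen_eq_zero_of_card_inter_eq_fifteen_n19 (hs : Simple M) (hline : ∀ L ∈ flatsQ M 2, L.card ≤ 3)
    (hplane : ∀ P ∈ flatsQ M 3, P.card ≤ 6) (hsolid : ∀ F ∈ flatsQ M 4, F.card ≤ 10) {G : Finset α}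
    (hcard : G.card = 19) {H₁ H₂ : Finset α} (hH₁ : H₁ ∈ flatsTr M G 6 16) (hH₂ : H₂ ∈ flatsTr M G 6 16)
    (hne : H₁ ≠ H₂) (h15 : ((H₁ ∩ H₂) ∩ G).card = 15) : hypTr M G 6 15 = 0 := by
  have hB := flats_le_four_card_le_ten hs hline hplane hsolid
  have hF : H₁ ∩ H₂ ∈ flatsQ M 5 :=
    inter_mem_flatsQ_of_large_traces (q := 7) (s := 16) (B := 10) (by norm_num) hB hH₁ hH₂ hne (by omega)
  unfold hypTr
  rw [Finset.card_eq_zero, Finset.eq_empty_iff_forall_notMem]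
  intro H hH
  have hH1 := mem_flatsTr.1 hH
  have hFH : H₁ ∩ H₂ ⊆ H := subset_of_card_add_card hB hF hH (by omega)
  have hFGH : (H₁ ∩ H₂) ∩ G ⊆ H ∩ G := by
    intro x hx
    rw [Finset.mem_inter] at hx ⊢
    exact ⟨hFH hx.1, hx.2⟩
  have heq : (H₁ ∩ H₂) ∩ G = H ∩ G := Finset.eq_of_subset_of_card_le hFGH (by omega)
  exact not_subset_of_mem_flatsTr_six hF hH (by rw [← heq]; exact Finset.inter_subset_left)

/-- Two `16`-traces meeting `G` in `14` points produce the `15`-trace `cl(F ∪ y)`, `y` the point of `G` outside both,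
with trace exactly `(F ∩ G) ∪ {y}` (`n = 19`; part E's construction made explicit). -/
theorem exists_fifteen_of_card_inter_eq_fourteen_n19 (hs : Simple M) (hline : ∀ L ∈ flatsQ M 2, L.card ≤ 3)
    (hplane : ∀ P ∈ flatsQ M 3, P.card ≤ 6) (hsolid : ∀ F ∈ flatsQ M 4, F.card ≤ 10) {G : Finset α}
    (hG : G ⊆ gr M) (hcard : G.card = 19) {H₁ H₂ : Finset α}
    (hH₁ : H₁ ∈ flatsTr M G 6 16) (hH₂ : H₂ ∈ flatsTr M G 6 16) (hne : H₁ ≠ H₂)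
    (h14 : ((H₁ ∩ H₂) ∩ G).card = 14) :
    ∃ K ∈ flatsTr M G 6 15, ∃ y ∈ G, y ∉ H₁ ∧ y ∉ H₂ ∧ K ∩ G = insert y ((H₁ ∩ H₂) ∩ G) := by
  have hB := flats_le_four_card_le_ten hs hline hplane hsolid
  have hF : H₁ ∩ H₂ ∈ flatsQ M 5 :=
    inter_mem_flatsQ_of_large_traces (q := 7) (s := 16) (B := 10) (by norm_num) hB hH₁ hH₂ hne (by omega)
  have hF' := mem_flatsQ.1 hF
  have h1 := mem_flatsTr.1 hH₁
  have h2 := mem_flatsTr.1 hH₂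
  -- the point `y` outside both traces
  have hU : (H₁ ∩ G) ∪ (H₂ ∩ G) ⊆ G := by
    intro x hx
    simp only [Finset.mem_union, Finset.mem_inter] at hx
    rcases hx with hx | hx
    · exact hx.2
    · exact hx.2
  have hUcard : ((H₁ ∩ G) ∪ (H₂ ∩ G)).card = 18 := by
    have := Finset.card_union_add_card_inter (H₁ ∩ G) (H₂ ∩ G)
    rw [← inter_inter_eq, h14, h1.2.1, h2.2.1] at this
    omega
  obtain ⟨y, hyG, hyU⟩ := Finset.exists_mem_notMem_of_card_lt_card (by rw [hUcard, hcard]; norm_num : ((H₁ ∩ G) ∪ (H₂ ∩ G)).card < G.card)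
  have hyH₁ : y ∉ H₁ := fun h => hyU (Finset.mem_union.2 (Or.inl (Finset.mem_inter.2 ⟨h, hyG⟩)))
  have hyH₂ : y ∉ H₂ := fun h => hyU (Finset.mem_union.2 (Or.inr (Finset.mem_inter.2 ⟨h, hyG⟩)))
  have hyF : y ∉ H₁ ∩ H₂ := fun h => hyH₁ (Finset.mem_inter.1 h).1
  -- `F ∩ G` spans `F`
  have hrFG : M.eRk (((H₁ ∩ H₂) ∩ G : Finset α) : Set α) = ((7 - 2 : ℕ) : ℕ∞) :=
    eRk_eq_of_subset_flat_of_flats_le (q := 7) (B := 10) (by norm_num) hB hG hF (Finset.Subset.refl _) (by omega)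
  have hclFG : M.closure (((H₁ ∩ H₂) ∩ G : Finset α) : Set α) = ((H₁ ∩ H₂ : Finset α) : Set α) := by
    have := (M.isRkFinite_of_finite (Finset.finite_toSet ((H₁ ∩ H₂) ∩ G))).closure_eq_closure_of_subset_of_eRk_ge_eRk
      (Finset.coe_subset.2 (Finset.inter_subset_left : (H₁ ∩ H₂) ∩ G ⊆ H₁ ∩ H₂)) (by rw [hrFG, hF'.2.2])
    rw [this, hF'.2.1.closure]
  -- `X = (F ∩ G) ∪ {y}` has rank `6`
  set X : Finset α := insert y ((H₁ ∩ H₂) ∩ G) with hXdef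
  have hXG : X ⊆ G := by
    intro x hx
    rw [hXdef, Finset.mem_insert] at hx
    rcases hx with hx | hx
    · rw [hx]; exact hyG
    · exact (Finset.mem_inter.1 hx).2
  have hyE : y ∈ M.E := by
    rw [← coe_gr M]
    exact Finset.mem_coe.2 (hG hyG)
  have hrX : M.eRk (X : Set α) = ((6 : ℕ) : ℕ∞) := by
    rw [hXdef, Finset.coe_insert, Matroid.eRk_insert_eq_add_one, hrFG]
    · norm_num
    · rw [Set.mem_sdiff, hclFG]
      exact ⟨hyE, fun h => hyF (Finset.mem_coe.1 h)⟩
  have hXcard : X.card = 15 := by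
    rw [hXdef, Finset.card_insert_of_notMem, h14]
    intro h
    exact hyF (Finset.mem_inter.1 h).1
  -- the hyperplane `K = cl X` has trace exactly `X`
  have hK := clF_mem_flatsTr hG hXG hrX
  have hXK : X ⊆ clF M X ∩ G := by
    intro x hx
    refine Finset.mem_inter.2 ⟨?_, hXG hx⟩
    rw [← Finset.mem_coe, coe_clF]
    exact M.subset_closure _ (by rw [← coe_gr M]; exact Finset.coe_subset.2 (hXG.trans hG)) (Finset.mem_coe.2 hx)
  have hFK : H₁ ∩ H₂ ⊆ clF M X := by
    intro x hx
    rw [← Finset.mem_coe, coe_clF]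
    have hsub : M.closure (((H₁ ∩ H₂) ∩ G : Finset α) : Set α) ⊆ M.closure (X : Set α) :=
      M.closure_subset_closure (Finset.coe_subset.2 (by rw [hXdef]; exact Finset.subset_insert _ _))
    exact hsub (by rw [hclFG]; exact Finset.mem_coe.2 hx)
  have hKX : clF M X ∩ G ⊆ X := by
    intro z hz
    rw [Finset.mem_inter] at hz
    by_cases hzF : z ∈ H₁ ∩ H₂
    · rw [hXdef]; exact Finset.mem_insert_of_mem (Finset.mem_inter.2 ⟨hzF, hz.2⟩)
    -- `z ∉ F`: `z = y` or `z` lies in one of the two traces and drags it into `K`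
    have hzE : z ∈ M.E := by
      rw [← coe_gr M]
      exact Finset.mem_coe.2 (hG hz.2)
    have hpull : ∀ H ∈ flatsTr M G 6 16, H₁ ∩ H₂ ⊆ H → z ∈ H → H = clF M X := by
      intro H hH hFH hzH
      have hH' := mem_flatsTr.1 hH
      have hrz : M.eRk ((insert z (H₁ ∩ H₂) : Finset α) : Set α) = ((6 : ℕ) : ℕ∞) := by
        rw [Finset.coe_insert, Matroid.eRk_insert_eq_add_one, hF'.2.2]
        · norm_num
        · rw [Set.mem_sdiff, hF'.2.1.closure]
          exact ⟨hzE, fun h => hzF (Finset.mem_coe.1 h)⟩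
      have hsub : H ⊆ clF M X :=
        subset_of_subset_of_eRk_eq hH'.1 (mem_flatsQ.1 (mem_flatsTr.1 hK).1).2.1
          (Finset.insert_subset hzH hFH) (Finset.insert_subset hz.1 hFK) hrz
      exact eq_of_subset_of_mem_flatsQ hH'.1 (mem_flatsTr.1 hK).1 hsub
    by_cases hzH₁ : z ∈ H₁
    · exfalso
      have := hpull H₁ hH₁ Finset.inter_subset_left hzH₁
      exact hyH₁ (by rw [this]; exact (Finset.mem_inter.1 (hXK (Finset.mem_insert_self _ _))).1)
    by_cases hzH₂ : z ∈ H₂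
    · exfalso
      have := hpull H₂ hH₂ Finset.inter_subset_right hzH₂
      exact hyH₂ (by rw [this]; exact (Finset.mem_inter.1 (hXK (Finset.mem_insert_self _ _))).1)
    -- `z ∉ H₁ ∪ H₂`, so `z = y` (the union has `17` points)
    have hzy : z = y := by
      by_contra hzy
      have hsub : insert z ((H₁ ∩ G) ∪ (H₂ ∩ G)) ⊆ G := by
        intro x hx
        rw [Finset.mem_insert] at hx
        rcases hx with hx | hx
        · rw [hx]; exact hz.2
        · exact hU hx
      have hcard' : (insert z ((H₁ ∩ G) ∪ (H₂ ∩ G))).card = 19 := by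
        rw [Finset.card_insert_of_notMem, hUcard]
        intro h
        rw [Finset.mem_union, Finset.mem_inter, Finset.mem_inter] at h
        rcases h with h | h
        · exact hzH₁ h.1
        · exact hzH₂ h.1
      have heq : insert z ((H₁ ∩ G) ∪ (H₂ ∩ G)) = G := Finset.eq_of_subset_of_card_le hsub (by omega)
      have hy' : y ∈ insert z ((H₁ ∩ G) ∪ (H₂ ∩ G)) := by rw [heq]; exact hyG
      rw [Finset.mem_insert] at hy'
      rcases hy' with hy' | hy'
      · exact hzy hy'.symm
      · exact hyU hy'
    rw [hzy, hXdef]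
    exact Finset.mem_insert_self _ _
  have hKG : clF M X ∩ G = X := Finset.Subset.antisymm hKX hXK
  rw [hKG, hXcard] at hK
  exact ⟨clF M X, hK, y, hyG, hyH₁, hyH₂, hKG⟩

/-- With exactly one `15`-trace, two `16`-traces meeting `G` in `14` points leave no third `16`-trace (`n = 19`). -/
theorem false_of_pair_fourteen_and_third_n19 (hs : Simple M) (hline : ∀ L ∈ flatsQ M 2, L.card ≤ 3)
    (hplane : ∀ P ∈ flatsQ M 3, P.card ≤ 6) (hsolid : ∀ F ∈ flatsQ M 4, F.card ≤ 10) {G : Finset α}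
    (hG : G ⊆ gr M) (hcard : G.card = 19) (h15 : hypTr M G 6 15 = 1) {H₁ H₂ H₃ : Finset α}
    (hH₁ : H₁ ∈ flatsTr M G 6 16) (hH₂ : H₂ ∈ flatsTr M G 6 16) (hH₃ : H₃ ∈ flatsTr M G 6 16) (h12 : H₁ ≠ H₂)
    (h13 : H₁ ≠ H₃) (h23 : H₂ ≠ H₃) (hf12 : ((H₁ ∩ H₂) ∩ G).card = 14) : False := by
  have hB := flats_le_four_card_le_ten hs hline hplane hsolid
  have hF : H₁ ∩ H₂ ∈ flatsQ M 5 :=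
    inter_mem_flatsQ_of_large_traces (q := 7) (s := 16) (B := 10) (by norm_num) hB hH₁ hH₂ h12 (by omega)
  have hF' := mem_flatsQ.1 hF
  have hH1 := mem_flatsTr.1 hH₁
  have hH2 := mem_flatsTr.1 hH₂
  have hH3 := mem_flatsTr.1 hH₃
  obtain ⟨K, hK, y, hyG, hyH₁, hyH₂, hKG⟩ :=
    exists_fifteen_of_card_inter_eq_fourteen_n19 hs hline hplane hsolid hG hcard hH₁ hH₂ h12 hf12
  -- the unique `15`-trace
  have huniq : ∀ K' ∈ flatsTr M G 6 15, K' = K := by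
    intro K' hK'
    unfold hypTr at h15
    obtain ⟨a, ha⟩ := Finset.card_eq_one.1 h15
    rw [ha, Finset.mem_singleton] at hK hK'
    rw [hK', hK]
  -- the pairs `(H₁, H₃)`, `(H₂, H₃)` meet in `13` or `14` points
  have hpair : ∀ {H : Finset α}, H ∈ flatsTr M G 6 16 → H ≠ H₃ →
      ((H ∩ H₃) ∩ G).card = 13 ∨ ((H ∩ H₃) ∩ G).card = 14 := by
    intro H hH hne
    have hle := card_inter_le_fifteen_n19 hH hH₃ hne
    have hge := two_mul_sub_le_card_inter_of_mem_flatsTr hH hH₃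
    have hn15 : ((H ∩ H₃) ∩ G).card ≠ 15 := by
      intro h
      have := hypTr_fifteen_eq_zero_of_card_inter_eq_fifteen_n19 hs hline hplane hsolid hcard hH hH₃ hne h
      omega
    omega
  -- the outside points of `F = H₁ ∩ H₂`: `x ∈ G ∖ F`, `x ≠ y` lies in `H₁` or `H₂`
  have hout : ∀ {x : α}, x ∈ G → x ∉ H₁ ∩ H₂ → x ≠ y → x ∈ H₁ ∨ x ∈ H₂ := by
    intro x hxG hxF hxy
    by_contra hnot
    rw [not_or] at hnot
    have hdisj : Disjoint ((H₁ ∩ G) \ (H₁ ∩ H₂)) ((H₂ ∩ G) \ (H₁ ∩ H₂)) := by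
      rw [Finset.disjoint_left]
      intro z hz hz'
      rw [Finset.mem_sdiff, Finset.mem_inter] at hz hz'
      exact hz.2 (Finset.mem_inter.2 ⟨hz.1.1, hz'.1.1⟩)
    have hcK : ((H₁ ∩ G) \ (H₁ ∩ H₂)).card = 2 := by
      have hEq : (H₁ ∩ H₂) ∩ (H₁ ∩ G) = (H₁ ∩ H₂) ∩ G := by
        ext z
        simp only [Finset.mem_inter]
        tauto
      rw [Finset.card_sdiff, hH1.2.1, hEq, hf12]
    have hcK' : ((H₂ ∩ G) \ (H₁ ∩ H₂)).card = 2 := by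
      have hEq : (H₁ ∩ H₂) ∩ (H₂ ∩ G) = (H₁ ∩ H₂) ∩ G := by
        ext z
        simp only [Finset.mem_inter]
        tauto
      rw [Finset.card_sdiff, hH2.2.1, hEq, hf12]
    have hsub : insert x (insert y (((H₁ ∩ G) \ (H₁ ∩ H₂)) ∪ ((H₂ ∩ G) \ (H₁ ∩ H₂)))) ⊆ G \ (H₁ ∩ H₂) := by
      intro z hz
      simp only [Finset.mem_insert, Finset.mem_union, Finset.mem_sdiff, Finset.mem_inter] at hz
      rw [Finset.mem_sdiff]
      rcases hz with hz | hz | hz | hz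
      · rw [hz]; exact ⟨hxG, hxF⟩
      · rw [hz]; exact ⟨hyG, fun h => hyH₁ (Finset.mem_inter.1 h).1⟩
      · exact ⟨hz.1.2, fun h => hz.2 (Finset.mem_inter.1 h)⟩
      · exact ⟨hz.1.2, fun h => hz.2 (Finset.mem_inter.1 h)⟩
    have hynot : y ∉ ((H₁ ∩ G) \ (H₁ ∩ H₂)) ∪ ((H₂ ∩ G) \ (H₁ ∩ H₂)) := by
      simp only [Finset.mem_union, Finset.mem_sdiff, Finset.mem_inter]
      rintro (h | h)
      · exact hyH₁ h.1.1
      · exact hyH₂ h.1.1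
    have hxnot : x ∉ insert y (((H₁ ∩ G) \ (H₁ ∩ H₂)) ∪ ((H₂ ∩ G) \ (H₁ ∩ H₂))) := by
      simp only [Finset.mem_insert, Finset.mem_union, Finset.mem_sdiff, Finset.mem_inter]
      rintro (h | h | h)
      · exact hxy h
      · exact hnot.1 h.1.1
      · exact hnot.2 h.1.1
    have hcard' := Finset.card_le_card hsub
    rw [Finset.card_insert_of_notMem hxnot, Finset.card_insert_of_notMem hynot, Finset.card_union_of_disjoint hdisj,
      hcK, hcK', Finset.card_sdiff, hcard, hf12] at hcard'
    omega
  -- a pair `(Hₐ, H₃)` meeting in `14` points is impossible: the same unique `15`-trace forces `H₃ ⊇ F`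
  have hkey : ∀ {Ha : Finset α}, Ha ∈ flatsTr M G 6 16 → (Ha = H₁ ∨ Ha = H₂) → Ha ≠ H₃ →
      ((Ha ∩ H₃) ∩ G).card = 14 → False := by
    intro Ha hHa hab hne hf
    obtain ⟨K', hK', y', hy'G, hy'Ha, hy'H₃, hK'G⟩ :=
      exists_fifteen_of_card_inter_eq_fourteen_n19 hs hline hplane hsolid hG hcard hHa hH₃ hne hf
    have hKK : K' = K := huniq K' hK'
    rw [hKK, hKG] at hK'G
    -- `y = y′`
    have hyy : y = y' := by
      have : y ∈ insert y' ((Ha ∩ H₃) ∩ G) := by rw [← hK'G]; exact Finset.mem_insert_self _ _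
      rw [Finset.mem_insert] at this
      rcases this with h | h
      · exact h
      · exfalso
        rw [Finset.mem_inter, Finset.mem_inter] at h
        rcases hab with hab | hab
        · exact hyH₁ (hab ▸ h.1.1)
        · exact hyH₂ (hab ▸ h.1.1)
    subst hyy
    -- `F ∩ G = (Hₐ ∩ H₃) ∩ G`, so the trace of `F` lies in `H₃` and `F ⊆ H₃`
    have hFG : (H₁ ∩ H₂) ∩ G = (Ha ∩ H₃) ∩ G := by
      ext z
      constructor
      · intro hz
        have : z ∈ insert y ((Ha ∩ H₃) ∩ G) := by rw [← hK'G]; exact Finset.mem_insert_of_mem hz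
        rw [Finset.mem_insert] at this
        rcases this with h | h
        · exfalso; rw [h] at hz; exact hyH₁ (Finset.mem_inter.1 (Finset.mem_inter.1 hz).1).1
        · exact h
      · intro hz
        have : z ∈ insert y ((H₁ ∩ H₂) ∩ G) := by rw [hK'G]; exact Finset.mem_insert_of_mem hz
        rw [Finset.mem_insert] at this
        rcases this with h | h
        · exfalso; rw [h] at hz; exact hy'Ha (Finset.mem_inter.1 (Finset.mem_inter.1 hz).1).1
        · exact h
    have hrFG : M.eRk (((H₁ ∩ H₂) ∩ G : Finset α) : Set α) = ((7 - 2 : ℕ) : ℕ∞) :=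
      eRk_eq_of_subset_flat_of_flats_le (q := 7) (B := 10) (by norm_num) hB hG hF (Finset.Subset.refl _) (by omega)
    have hFH₃ : H₁ ∩ H₂ ⊆ H₃ :=
      subset_of_subset_of_eRk_eq hF (mem_flatsQ.1 hH3.1).2.1 Finset.inter_subset_left
        (by rw [hFG]; intro z hz; exact (Finset.mem_inter.1 (Finset.mem_inter.1 hz).1).2) hrFG
    -- a point of `H₃ ∩ G` outside `F` lies in `H₁` or `H₂` (not `y`, which is outside `H₃`): `H₃ = H₁` or `H₂`
    obtain ⟨x, hxH₃, hxF⟩ := Finset.not_subset.1 (not_subset_of_mem_flatsTr_six hF hH₃)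
    rw [Finset.mem_inter] at hxH₃
    have hxy : x ≠ y := fun h => hy'H₃ (h ▸ hxH₃.1)
    have hxE : x ∈ M.E := by
      rw [← coe_gr M]
      exact Finset.mem_coe.2 (hG hxH₃.2)
    rcases hout hxH₃.2 hxF hxy with hx | hx
    · exact h13 (eq_of_mem_of_subset_flatsQ_six hF hH1.1 hH3.1 Finset.inter_subset_left hFH₃ hxE hxF hx hxH₃.1)
    · exact h23 (eq_of_mem_of_subset_flatsQ_six hF hH2.1 hH3.1 Finset.inter_subset_right hFH₃ hxE hxF hx hxH₃.1)
  -- so both pairs meet in `13` points: the complement of `H₃` lies inside `F ∩ G`, and `F ∩ H₃` is too big for its rank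
  have hf13 : ((H₁ ∩ H₃) ∩ G).card = 13 := by
    rcases hpair hH₁ h13 with h | h
    · exact h
    · exact (hkey hH₁ (Or.inl rfl) h13 h).elim
  have hf23 : ((H₂ ∩ H₃) ∩ G).card = 13 := by
    rcases hpair hH₂ h23 with h | h
    · exact h
    · exact (hkey hH₂ (Or.inr rfl) h23 h).elim
  have hC₃ : G \ H₃ ⊆ (H₁ ∩ H₂) ∩ G := by
    intro c hc
    rw [Finset.mem_sdiff] at hc
    rw [Finset.mem_inter, Finset.mem_inter]
    refine ⟨⟨?_, ?_⟩, hc.1⟩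
    · rcases mem_or_mem_of_card_inter_eq_thirteen hcard hH₁ hH₃ hf13 hc.1 with h | h
      · exact h
      · exact absurd h hc.2
    · rcases mem_or_mem_of_card_inter_eq_thirteen hcard hH₂ hH₃ hf23 hc.1 with h | h
      · exact h
      · exact absurd h hc.2
  have hnot : ¬ H₁ ∩ H₂ ⊆ H₃ := by
    intro hsub
    obtain ⟨c, hc⟩ : (G \ H₃).Nonempty := by
      rw [← Finset.card_pos, Finset.card_sdiff, hcard, hH3.2.1]; norm_num
    have := hC₃ hc
    rw [Finset.mem_sdiff] at hc
    exact hc.2 (hsub (Finset.mem_inter.1 this).1)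
  obtain ⟨b, hS, hb⟩ := exists_inter_mem_flatsQ_lt_of_not_subset hF (mem_flatsQ.1 hH3.1).2.1 hnot
  have hten := hB b (by omega) _ hS
  -- `F ∩ H₃` contains `(F ∩ G) ∖ (G ∖ H₃)`, at least `14 − 3 = 11` points
  have hsub : ((H₁ ∩ H₂) ∩ G) \ (G \ H₃) ⊆ (H₁ ∩ H₂) ∩ H₃ := by
    intro z hz
    rw [Finset.mem_sdiff, Finset.mem_sdiff, Finset.mem_inter] at hz
    rw [Finset.mem_inter]
    refine ⟨hz.1.1, ?_⟩
    by_contra h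
    exact hz.2 ⟨hz.1.2, h⟩
  have h1 := Finset.card_le_card hsub
  have h2 := Finset.card_le_card hC₃
  have h3 := Finset.card_sdiff_of_subset hC₃
  have h4 : (G \ H₃).card = 3 := by rw [Finset.card_sdiff, hcard, hH3.2.1]
  omega

/-- **One `15`-trace leaves at most three `16`-traces** (`n = 19`, the core): the class `(h₁₆ = 4, h₁₅ = 1)` is empty. -/
theorem hypTr_sixteen_le_three_of_fifteen_one (hs : Simple M) (hline : ∀ L ∈ flatsQ M 2, L.card ≤ 3)
    (hplane : ∀ P ∈ flatsQ M 3, P.card ≤ 6) (hsolid : ∀ F ∈ flatsQ M 4, F.card ≤ 10) {G : Finset α}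
    (hG : G ⊆ gr M) (hcard : G.card = 19) (h15 : hypTr M G 6 15 = 1) : hypTr M G 6 16 ≤ 3 := by
  by_contra hlt
  rw [not_le] at hlt
  obtain ⟨H₁, H₂, H₃, hH₁, hH₂, hH₃, h12, h13, h23⟩ :=
    Finset.two_lt_card_iff.1 (by unfold hypTr at hlt; omega : 2 < (flatsTr M G 6 16).card)
  obtain ⟨H₄, hH₄'⟩ : ((flatsTr M G 6 16) \ {H₁, H₂, H₃}).Nonempty := by
    rw [← Finset.card_pos]
    have hle := Finset.card_le_card (Finset.inter_subset_right : (flatsTr M G 6 16) ∩ {H₁, H₂, H₃} ⊆ {H₁, H₂, H₃})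
    have h3 : ({H₁, H₂, H₃} : Finset (Finset α)).card ≤ 3 := Finset.card_le_three
    have := Finset.card_sdiff_add_card_inter (flatsTr M G 6 16) {H₁, H₂, H₃}
    unfold hypTr at hlt
    omega
  rw [Finset.mem_sdiff, Finset.mem_insert, Finset.mem_insert, Finset.mem_singleton] at hH₄'
  obtain ⟨hH₄, hH₄ne⟩ := hH₄'
  have h14 : H₁ ≠ H₄ := fun h => hH₄ne (Or.inl h.symm)
  have h24 : H₂ ≠ H₄ := fun h => hH₄ne (Or.inr (Or.inl h.symm))
  have h34 : H₃ ≠ H₄ := fun h => hH₄ne (Or.inr (Or.inr h.symm))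
  have hpair : ∀ {H H' : Finset α}, H ∈ flatsTr M G 6 16 → H' ∈ flatsTr M G 6 16 → H ≠ H' →
      ((H ∩ H') ∩ G).card = 13 ∨ ((H ∩ H') ∩ G).card = 14 := by
    intro H H' hH hH' hne
    have hle := card_inter_le_fifteen_n19 hH hH' hne
    have hge := two_mul_sub_le_card_inter_of_mem_flatsTr hH hH'
    have hn15 : ((H ∩ H') ∩ G).card ≠ 15 := by
      intro h
      have := hypTr_fifteen_eq_zero_of_card_inter_eq_fifteen_n19 hs hline hplane hsolid hcard hH hH' hne h
      omega
    omega
  have hk := fun {H H' H'' : Finset α} (hH : H ∈ flatsTr M G 6 16) (hH' : H' ∈ flatsTr M G 6 16)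
    (hH'' : H'' ∈ flatsTr M G 6 16) (a : H ≠ H') (b : H ≠ H'') (c : H' ≠ H'') (hf : ((H ∩ H') ∩ G).card = 14) =>
    false_of_pair_fourteen_and_third_n19 hs hline hplane hsolid hG hcard h15 hH hH' hH'' a b c hf
  rcases hpair hH₁ hH₂ h12 with h | h
  · rcases hpair hH₁ hH₃ h13 with h' | h'
    · rcases hpair hH₁ hH₄ h14 with h'' | h''
      · rcases hpair hH₂ hH₃ h23 with g | g
        · rcases hpair hH₂ hH₄ h24 with g' | g'
          · rcases hpair hH₃ hH₄ h34 with g'' | g''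
            · exact false_of_four_disjoint hs hline hplane hsolid hcard hH₁ hH₂ hH₃ hH₄ h12
                (fun hx => mem_or_mem_of_card_inter_eq_thirteen hcard hH₁ hH₃ h' hx)
                (fun hx => mem_or_mem_of_card_inter_eq_thirteen hcard hH₁ hH₄ h'' hx)
                (fun hx => mem_or_mem_of_card_inter_eq_thirteen hcard hH₂ hH₃ g hx)
                (fun hx => mem_or_mem_of_card_inter_eq_thirteen hcard hH₂ hH₄ g' hx)
                (fun hx => mem_or_mem_of_card_inter_eq_thirteen hcard hH₃ hH₄ g'' hx)
            · exact hk hH₃ hH₄ hH₁ h34 h13.symm h14.symm g''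
          · exact hk hH₂ hH₄ hH₁ h24 h12.symm h14.symm g'
        · exact hk hH₂ hH₃ hH₁ h23 h12.symm h13.symm g
      · exact hk hH₁ hH₄ hH₂ h14 h12 h24.symm h''
    · exact hk hH₁ hH₃ hH₂ h13 h12 h23.symm h'
  · exact hk hH₁ hH₂ hH₃ h12 h13 h23 h

end PercRepro.Night4
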